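import Literature.Topology.FourManifolds.SubsphereParam
import Literature.Topology.FourManifolds.SubsphereMorse
import Literature.Topology.FourManifolds.SideComparison
import Literature.Topology.FourManifolds.AlexanderTools
import HarnessLib

/-!
# The side function of the sub-sphere of the capped-ball step: certification and co-orientation

Topic `Literature/Topology/FourManifolds`; fact seat of Alexander's theorem
(`provefact-Literature.Topology.FourManifolds.SphereEmbedding.schoenflies_exists_ball`, Schultens
(2014), Thm. 3.2.5).  **Everything in this file is proved; no definitions, no named facts.**

With `W = subSphere F P E₁ s δ ε₀` the smoothed sphere `S₁` of the step (a smoothly embedded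
`2`-sphere, `SubsphereParam.lean`), this file produces the defining data of the solid `B` it
bounds ("`S₁` … bounds a `3`-ball `B`", Schultens (2014), proof of Thm. 3.2.5, PDF p. 45), in a
form valid both for the solid of the sphere and for the (big-ball truncated) solid of its
complement:

* §1 `W ⊆ {F₂ ≤ 0}`; the position of `W` (in the closed box at heights `[-6s, s]`, or on the
  absorbed disc `E₂` off the box); `W ∩ E₁` is the cutting circle.
* §2 **certification**: if a side function `F_B` of `W` (zero set `W`, regular, `{F_B ≤ 0}`
  compact, `{F_B < 0}` connected) had negative co-orientation factor at the apex, the upper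
  tube above the dome, hence the kept disc `D₁` minus the circle, would lie inside `B`,
  contradicting that a far point of `D₁` lies strictly above (or below) all of `W` and hence
  outside `B` (`factor_pos_apex`); so the factor is positive along `W`, the signs of `F_B` and of
  the lid function agree on the lid zone (`sign_iff_of_mem_lidZone`), and then
  **`{F₂ > 0} ⊆ {F_B > 0}`** (`fillFun_pos_of_certified`): the connected `{F_B < 0}` meets the
  boundary `{F₂ = 0}` only at points of `W`.
* §3 `CappedBallLid.exists_subSide` — the side function `F_B` and the embedding `f_B` with all
  the properties consumed by the absorption (`SweepDriver.exists_sweepStep`).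

## References
* J. Schultens, *Introduction to 3-Manifolds*, GSM 151, AMS (2014), Thm. 3.2.5, PDF pp. 42–45.
* J. W. Alexander, *On the subdivision of 3-space by a polyhedron*, PNAS 10 (1924), 6–8.
-/

open scoped RealInnerProductSpace Topology Manifold ContDiff
open Set Filter Metric Function

noncomputable section

namespace Literature.Topology.FourManifolds

namespace CappedBallLid

variable {F : EuclideanSpace ℝ (Fin 3) → ℝ} {P : ℝ → ℝ} {E₁ E₂ : Set (EuclideanSpace ℝ (Fin 3))}
  {w₀ η₀ ε₀ s δ : ℝ}

/-! ### §1 Position of the sub-sphere -/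

/-- **`W ⊆ {F₂ ≤ 0}`**: on the lid piece `F₂ ≤ min (F, w - 1) ≤ w - 1 = G = 0`, elsewhere
`F₂ = 0`. [folklore] -/
theorem fillFun_nonpos_of_mem_subSphere (hP : Admissible P) (hN : StepNF F E₁ E₂ w₀ η₀ ε₀)
    (hS : StepScale s δ w₀ η₀) {x : EuclideanSpace ℝ (Fin 3)} (hx : x ∈ subSphere F P E₁ s δ ε₀) :
    fillFun F P s δ ((1 + s) ^ 2 + ε₀ + 2) x ≤ 0 := by
  obtain ⟨hs, hs1, hsw, hsη, hδ, hδs⟩ := scales hS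
  rcases mem_lidPiece_or_fillFun_eq_zero hP hN hS hx with ⟨hG, hz⟩ | h
  · obtain ⟨hzs, hhsq⟩ := bounds_of_lidFun_eq_zero hP hS hG
    have hw : fillWeight P s δ ((1 + s) ^ 2 + ε₀ + 2) x = 1 + lidFun P s x :=
      fillWeight_eq_of_mem_box hs (by nlinarith) hz (by linarith)
    have := fillFun_le_min hP.hPge hδ (F := F) (s := s) (M := (1 + s) ^ 2 + ε₀ + 2) x (P := P)
    rw [hw, hG] at this
    linarith [min_le_right (F x) (1 + (0:ℝ) - 1)]
  · exact h.le


/-- **The position of the sub-sphere**: a point of `W` lies in the closed box at height in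
`[-6s, s]`, or on `E₂` off the closed box. [folklore] -/
theorem mem_closedBox_or_of_mem_subSphere (hP : Admissible P) (hN : StepNF F E₁ E₂ w₀ η₀ ε₀)
    (hS : StepScale s δ w₀ η₀) {x : EuclideanSpace ℝ (Fin 3)} (hx : x ∈ subSphere F P E₁ s δ ε₀) :
    (x ∈ closedBox s ∧ -6 * s ≤ x 2 ∧ x 2 ≤ s) ∨ (x ∈ E₂ ∧ x ∉ closedBox s) := by
  obtain ⟨hs, hs1, hsw, hsη, hδ, hδs⟩ := scales hS
  rw [subSphere_eq hP hN hS] at hx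
  rcases hx with (⟨hG, hz3⟩ | ⟨-, hz5, hxB⟩) | ⟨hE₂, hxB⟩
  · obtain ⟨hzs, hhsq⟩ := bounds_of_lidFun_eq_zero hP hS hG
    exact Or.inl ⟨⟨by nlinarith, by linarith, by linarith⟩, by linarith, hzs⟩
  · exact Or.inl ⟨hxB, hxB.2.1, by linarith⟩
  · exact Or.inr ⟨hE₂, hxB⟩

/-- **`W ∩ E₁` is the cutting circle** `{ρ² = 1, x₂ = 0}`. [folklore] -/
theorem hsq_eq_one_and_of_mem (hP : Admissible P) (hN : StepNF F E₁ E₂ w₀ η₀ ε₀) (hS : StepScale s δ w₀ η₀)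
    {x : EuclideanSpace ℝ (Fin 3)} (hx : x ∈ subSphere F P E₁ s δ ε₀) (hxE₁ : x ∈ E₁) :
    hsq x = 1 ∧ x 2 = 0 := by
  obtain ⟨hs, hs1, hsw, hsη, hδ, hδs⟩ := scales hS
  rcases mem_closedBox_or_of_mem_subSphere hP hN hS hx with ⟨hxB, hz6, hzs⟩ | ⟨hE₂, -⟩
  · obtain ⟨h1, h2, h3⟩ := id hxB
    have hF : F x = 0 := hN.eq_zero_of_mem_left hxE₁
    have hbox1 : hsq x ≤ (1 + 3 * w₀) ^ 2 := by nlinarith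
    have hbox2 : |x 2| ≤ η₀ := abs_le.2 ⟨by linarith, by linarith⟩
    have hh : hsq x = 1 := hN.hsq_eq_one hF hbox1 hbox2
    have hz0 : 0 ≤ x 2 := hN.hE₁box x hxE₁ hbox1 hbox2
    refine ⟨hh, ?_⟩
    rw [subSphere_eq hP hN hS] at hx
    rcases hx with (⟨hG, -⟩ | ⟨-, hz5, -⟩) | ⟨-, hxB'⟩
    · -- a lid zero on the wall above height `0` is impossible: there `G ≥ x₂ > 0`
      by_contra hne
      have hzpos : 0 < x 2 := lt_of_le_of_ne hz0 (Ne.symm hne)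
      have htop : topFun s x = x 2 := by unfold topFun; rw [hh]; ring
      have := max_le_lidFun hP.hPge hs x
      rw [hG, htop] at this
      linarith [le_max_left (x 2) (rimFun s x)]
    · linarith
    · exact absurd hxB hxB'
  · exact hN.hE₁₂ ⟨hxE₁, hE₂⟩

/-- The closed exterior `{R ≤ ‖x‖}` of a ball in `ℝ³` (`R > 0`) is preconnected. [folklore] -/
theorem isPreconnected_setOf_le_norm {R : ℝ} (hR : 0 < R) :
    IsPreconnected {x : EuclideanSpace ℝ (Fin 3) | R ≤ ‖x‖} := by
  have hr : 1 < Module.rank ℝ (EuclideanSpace ℝ (Fin 3)) := by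
    rw [← Module.finrank_eq_rank, finrank_euclideanSpace_fin]; exact_mod_cast (by norm_num : 1 < 3)
  have heq : {x : EuclideanSpace ℝ (Fin 3) | R ≤ ‖x‖} =
      (fun p : EuclideanSpace ℝ (Fin 3) × ℝ => p.2 • p.1) '' (sphere 0 1 ×ˢ Ici R) := by
    ext x
    constructor
    · intro hx
      have hx' : R ≤ ‖x‖ := hx
      have hn : 0 < ‖x‖ := lt_of_lt_of_le hR hx'
      refine ⟨(‖x‖⁻¹ • x, ‖x‖), ⟨?_, hx'⟩, ?_⟩
      · rw [mem_sphere_zero_iff_norm, norm_smul, norm_inv, norm_norm, inv_mul_cancel₀ hn.ne']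
      · simp [smul_smul, mul_inv_cancel₀ hn.ne']
    · rintro ⟨⟨y, t⟩, ⟨hy, ht⟩, rfl⟩
      have hy1 : ‖y‖ = 1 := mem_sphere_zero_iff_norm.1 hy
      have ht' : R ≤ t := ht
      show R ≤ ‖t • y‖
      rw [norm_smul, hy1, mul_one, Real.norm_eq_abs, abs_of_pos (lt_of_lt_of_le hR ht')]
      exact ht'
  rw [heq]
  exact ((isPreconnected_sphere hr 0 1).prod isPreconnected_Ici).image _
    ((continuous_snd.smul continuous_fst).continuousOn)

/-- The closed exterior `{R ≤ ‖x‖}` is unbounded. [folklore] -/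
theorem not_isBounded_setOf_le_norm (R : ℝ) :
    ¬ Bornology.IsBounded {x : EuclideanSpace ℝ (Fin 3) | R ≤ ‖x‖} := by
  intro hb
  obtain ⟨C, hC⟩ := hb.subset_closedBall 0
  set t : ℝ := max (max C R) 0 + 1 with ht
  have ht0 : 0 < t := by rw [ht]; linarith [le_max_right (max C R) 0]
  have hnorm : ‖(t • EuclideanSpace.single (2 : Fin 3) (1 : ℝ) : EuclideanSpace ℝ (Fin 3))‖ = t := by
    rw [norm_smul, Real.norm_eq_abs, abs_of_pos ht0]; simp
  have hmem : (t • EuclideanSpace.single (2 : Fin 3) (1 : ℝ) : EuclideanSpace ℝ (Fin 3)) ∈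
      {x : EuclideanSpace ℝ (Fin 3) | R ≤ ‖x‖} := by
    show R ≤ _; rw [hnorm, ht]; linarith [le_max_right C R, le_max_left (max C R) 0]
  have := hC hmem
  rw [mem_closedBall, dist_zero_right, hnorm, ht] at this
  linarith [le_max_left C R, le_max_left (max C R) 0]

/-! ### §2 Certification -/

/-- The derivative of `t ↦ H(a + t v)` at `0`; negative derivative means negative values just to
the right (given `H a = 0`) — DEPRECATED duplicate of `ExpHeight.exists_pos_apply_add_smul_neg`
(`ExpHeightCritical.lean`, any real normed space; librarian dedup 2026-08-16, work item dedup-01242);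
kept under its old name as a one-line alias proof (never deleted), no longer used in this file.
[folklore] -/
@[deprecated ExpHeight.exists_pos_apply_add_smul_neg (since := "2026-08-16")]
theorem eventually_neg_of_fderiv_neg {H : EuclideanSpace ℝ (Fin 3) → ℝ} (hH : Differentiable ℝ H)
    {a v : EuclideanSpace ℝ (Fin 3)} (ha : H a = 0) (hneg : fderiv ℝ H a v < 0) :
    ∀ᶠ t in 𝓝[>] (0 : ℝ), H (a + t • v) < 0 :=
  ExpHeight.exists_pos_apply_add_smul_neg hH ha hneg

/-- **The co-orientation factor has constant sign along the (connected) sub-sphere.**  If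
`DFB = μ(x) DG_B` with `μ(x) ≠ 0` at every point of `W`, both differentials continuous, and
`μ > 0` at one point of `W`, then `μ > 0` at every point of `W`. [folklore] -/
theorem factor_pos_of_connected (hP : Admissible P) (hN : StepNF F E₁ E₂ w₀ η₀ ε₀) (hS : StepScale s δ w₀ η₀)
    (hW : IsConnected (subSphere F P E₁ s δ ε₀)) {FB : EuclideanSpace ℝ (Fin 3) → ℝ} (hFBs : ContDiff ℝ 1 FB)
    (hprop : ∀ x ∈ subSphere F P E₁ s δ ε₀, ∃ μ : ℝ, μ ≠ 0 ∧
      fderiv ℝ FB x = μ • fderiv ℝ (subFun F P s δ ((1 + s) ^ 2 + ε₀ + 2)) x)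
    {x₀ : EuclideanSpace ℝ (Fin 3)} (hx₀ : x₀ ∈ subSphere F P E₁ s δ ε₀)
    (hx₀p : ∃ μ : ℝ, 0 < μ ∧ fderiv ℝ FB x₀ = μ • fderiv ℝ (subFun F P s δ ((1 + s) ^ 2 + ε₀ + 2)) x₀) :
    ∀ x ∈ subSphere F P E₁ s δ ε₀, ∃ μ : ℝ, 0 < μ ∧
      fderiv ℝ FB x = μ • fderiv ℝ (subFun F P s δ ((1 + s) ^ 2 + ε₀ + 2)) x := by
  set M := (1 + s) ^ 2 + ε₀ + 2 with hM
  set W := subSphere F P E₁ s δ ε₀ with hWdef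
  have hGBs : ContDiff ℝ ∞ (subFun F P s δ M) := contDiff_subFun hN.hF hP.hP
  have hcDF : Continuous fun x => fderiv ℝ FB x := hFBs.continuous_fderiv (by simp)
  have hcDG : Continuous fun x => fderiv ℝ (subFun F P s δ M) x := hGBs.continuous_fderiv (by simp)
  -- the sign `σ ∈ {1, -1}` of the factor is locally constant along `W`
  have key : ∀ x ∈ W, ∀ (σ : ℝ), σ * σ = 1 →
      (∃ μ : ℝ, 0 < σ * μ ∧ fderiv ℝ FB x = μ • fderiv ℝ (subFun F P s δ M) x) →
      ∃ O ∈ 𝓝 x, ∀ y ∈ O, y ∈ W →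
        ∃ μ : ℝ, 0 < σ * μ ∧ fderiv ℝ FB y = μ • fderiv ℝ (subFun F P s δ M) y := by
    intro x hx σ hσ ⟨μ, hμ, hD⟩
    obtain ⟨u, hu⟩ : ∃ u, fderiv ℝ (subFun F P s δ M) x u ≠ 0 := by
      by_contra hall; push Not at hall
      exact fderiv_subFun_ne_zero_of_mem hP hN hS hx (ContinuousLinearMap.ext hall)
    have hDu : fderiv ℝ FB x u = μ * fderiv ℝ (subFun F P s δ M) x u := by
      rw [hD, FunLike.coe_smul, Pi.smul_apply, smul_eq_mul]
    have hprod : 0 < σ * (fderiv ℝ FB x u * fderiv ℝ (subFun F P s δ M) x u) := by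
      rw [hDu]
      have : 0 < fderiv ℝ (subFun F P s δ M) x u * fderiv ℝ (subFun F P s δ M) x u := mul_self_pos.2 hu
      nlinarith
    have hc : Continuous fun y => σ * (fderiv ℝ FB y u * fderiv ℝ (subFun F P s δ M) y u) :=
      continuous_const.mul ((hcDF.clm_apply continuous_const).mul (hcDG.clm_apply continuous_const))
    refine ⟨_, hc.continuousAt.eventually (eventually_gt_nhds hprod), fun y hy hyW => ?_⟩
    obtain ⟨μ', -, hD'⟩ := hprop y hyW
    refine ⟨μ', ?_, hD'⟩
    have e : fderiv ℝ FB y u = μ' * fderiv ℝ (subFun F P s δ M) y u := by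
      rw [hD', FunLike.coe_smul, Pi.smul_apply, smul_eq_mul]
    have hy' : 0 < σ * (μ' * fderiv ℝ (subFun F P s δ M) y u * fderiv ℝ (subFun F P s δ M) y u) := by
      have := hy; simp only [mem_setOf_eq, e] at this; exact this
    have hsq' : 0 ≤ fderiv ℝ (subFun F P s δ M) y u * fderiv ℝ (subFun F P s δ M) y u :=
      mul_self_nonneg _
    by_contra hle
    push Not at hle
    have : σ * μ' * (fderiv ℝ (subFun F P s δ M) y u * fderiv ℝ (subFun F P s δ M) y u) ≤ 0 :=
      mul_nonpos_of_nonpos_of_nonneg hle hsq'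
    nlinarith
  -- the two relatively open parts of `W`
  have hOp : ∀ x ∈ W, (∃ μ : ℝ, 0 < μ ∧ fderiv ℝ FB x = μ • fderiv ℝ (subFun F P s δ M) x) →
      ∃ O ∈ 𝓝 x, ∀ y ∈ O, y ∈ W → ∃ μ : ℝ, 0 < μ ∧ fderiv ℝ FB y = μ • fderiv ℝ (subFun F P s δ M) y := by
    intro x hx ⟨μ, hμ, hD⟩
    obtain ⟨O, hO, h⟩ := key x hx 1 (by norm_num) ⟨μ, by linarith, hD⟩
    exact ⟨O, hO, fun y hy hyW => by obtain ⟨μ', h1, h2⟩ := h y hy hyW; exact ⟨μ', by linarith, h2⟩⟩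
  have hOm : ∀ x ∈ W, (∃ μ : ℝ, μ < 0 ∧ fderiv ℝ FB x = μ • fderiv ℝ (subFun F P s δ M) x) →
      ∃ O ∈ 𝓝 x, ∀ y ∈ O, y ∈ W → ∃ μ : ℝ, μ < 0 ∧ fderiv ℝ FB y = μ • fderiv ℝ (subFun F P s δ M) y := by
    intro x hx ⟨μ, hμ, hD⟩
    obtain ⟨O, hO, h⟩ := key x hx (-1) (by norm_num) ⟨μ, by linarith, hD⟩
    exact ⟨O, hO, fun y hy hyW => by obtain ⟨μ', h1, h2⟩ := h y hy hyW; exact ⟨μ', by linarith, h2⟩⟩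
  choose! Op hOpn hOpW using hOp
  choose! Om hOmn hOmW using hOm
  set U₁ : Set (EuclideanSpace ℝ (Fin 3)) :=
    ⋃ x ∈ {x ∈ W | ∃ μ : ℝ, 0 < μ ∧ fderiv ℝ FB x = μ • fderiv ℝ (subFun F P s δ M) x}, interior (Op x) with hU₁
  set U₂ : Set (EuclideanSpace ℝ (Fin 3)) :=
    ⋃ x ∈ {x ∈ W | ∃ μ : ℝ, μ < 0 ∧ fderiv ℝ FB x = μ • fderiv ℝ (subFun F P s δ M) x}, interior (Om x) with hU₂
  have hU₁o : IsOpen U₁ := isOpen_biUnion fun _ _ => isOpen_interior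
  have hU₂o : IsOpen U₂ := isOpen_biUnion fun _ _ => isOpen_interior
  have hcover : W ⊆ U₁ ∪ U₂ := by
    intro x hx
    obtain ⟨μ, hμ0, hD⟩ := hprop x hx
    rcases lt_or_gt_of_ne hμ0 with hneg | hpos
    · exact Or.inr (mem_iUnion₂.2 ⟨x, ⟨hx, ⟨μ, hneg, hD⟩⟩,
        mem_interior_iff_mem_nhds.2 (hOmn x hx ⟨μ, hneg, hD⟩)⟩)
    · exact Or.inl (mem_iUnion₂.2 ⟨x, ⟨hx, ⟨μ, hpos, hD⟩⟩,
        mem_interior_iff_mem_nhds.2 (hOpn x hx ⟨μ, hpos, hD⟩)⟩)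
  have hU₁W : ∀ y ∈ U₁, y ∈ W → ∃ μ : ℝ, 0 < μ ∧ fderiv ℝ FB y = μ • fderiv ℝ (subFun F P s δ M) y := by
    intro y hy hyW
    obtain ⟨x, ⟨hx, hxp⟩, hyx⟩ := mem_iUnion₂.1 hy
    exact hOpW x hx hxp y (interior_subset hyx) hyW
  have hU₂W : ∀ y ∈ U₂, y ∈ W → ∃ μ : ℝ, μ < 0 ∧ fderiv ℝ FB y = μ • fderiv ℝ (subFun F P s δ M) y := by
    intro y hy hyW
    obtain ⟨x, ⟨hx, hxm⟩, hyx⟩ := mem_iUnion₂.1 hy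
    exact hOmW x hx hxm y (interior_subset hyx) hyW
  have hdisj : ∀ y ∈ W, (∃ μ : ℝ, 0 < μ ∧ fderiv ℝ FB y = μ • fderiv ℝ (subFun F P s δ M) y) →
      (∃ μ : ℝ, μ < 0 ∧ fderiv ℝ FB y = μ • fderiv ℝ (subFun F P s δ M) y) → False := by
    intro y hyW ⟨μ, hμ, hD⟩ ⟨μ', hμ', hD'⟩
    have hne := fderiv_subFun_ne_zero_of_mem hP hN hS hyW
    have : (μ - μ') • fderiv ℝ (subFun F P s δ M) y = 0 := by rw [sub_smul, ← hD, ← hD', sub_self]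
    rcases smul_eq_zero.1 this with h | h
    · linarith
    · exact hne h
  have hx₀U₁ : x₀ ∈ U₁ := by
    obtain ⟨μ, hμ, hD⟩ := hx₀p
    exact mem_iUnion₂.2 ⟨x₀, ⟨hx₀, ⟨μ, hμ, hD⟩⟩, mem_interior_iff_mem_nhds.2 (hOpn x₀ hx₀ ⟨μ, hμ, hD⟩)⟩
  intro x hx
  by_contra hxp
  have hxU₂ : x ∈ U₂ := by
    rcases hcover hx with h | h
    · exact absurd (hU₁W x h hx) hxp
    · exact h
  obtain ⟨y, hyW, hy₁, hy₂⟩ := hW.isPreconnected U₁ U₂ hU₁o hU₂o hcover ⟨x₀, hx₀, hx₀U₁⟩ ⟨x, hx, hxU₂⟩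
  exact hdisj y hyW (hU₁W y hy₁ hyW) (hU₂W y hy₂ hyW)


/-- **Sign agreement on the lid zone.**  Let `F_B` be `C¹` with zero set the sub-sphere `W` and
positively co-oriented with `G_B` along `W`.  Then on the open lid zone
`LZ₀ = {ρ² < (1+2s)², -5s/2 < x₂ < 3s/2}` (where `G_B = G`) the signs of `F_B` and of the lid
function `G` agree.  Proof: the set of points of `LZ₀` where they agree is nonempty (the apex),
open (near a point of `W` by `SideComparison.eventually_sign_iff`; near another point by
continuity) and closed in the connected `LZ₀`. [folklore] -/
theorem sign_iff_of_mem_lidZone (hP : Admissible P) (hN : StepNF F E₁ E₂ w₀ η₀ ε₀) (hS : StepScale s δ w₀ η₀)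
    {FB : EuclideanSpace ℝ (Fin 3) → ℝ} (hFBs : ContDiff ℝ 1 FB)
    (hFBZ : ∀ x, FB x = 0 ↔ x ∈ subSphere F P E₁ s δ ε₀)
    (hco : ∀ x ∈ subSphere F P E₁ s δ ε₀, ∃ μ : ℝ, 0 < μ ∧
      fderiv ℝ FB x = μ • fderiv ℝ (subFun F P s δ ((1 + s) ^ 2 + ε₀ + 2)) x)
    {y : EuclideanSpace ℝ (Fin 3)} (hy1 : hsq y < (1 + 2 * s) ^ 2) (hy2 : -(5 * s / 2) < y 2) (hy3 : y 2 < 3 * s / 2) :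
    (FB y < 0 ↔ lidFun P s y < 0) ∧ (0 < FB y ↔ 0 < lidFun P s y) := by
  obtain ⟨hs, hs1, hsw, hsη, hδ, hδs⟩ := scales hS
  set M := (1 + s) ^ 2 + ε₀ + 2 with hM
  set W := subSphere F P E₁ s δ ε₀ with hW
  set LZ : Set (EuclideanSpace ℝ (Fin 3)) := {x | hsq x < (1 + 2 * s) ^ 2 ∧ -(5 * s / 2) < x 2 ∧ x 2 < 3 * s / 2}
    with hLZ
  have hLZo : IsOpen LZ := (isOpen_lt continuous_hsq continuous_const).inter
    ((isOpen_lt continuous_const (continuous_coord 2)).inter (isOpen_lt (continuous_coord 2) continuous_const))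
  -- on `LZ`: `G_B = G`, and `G = 0 ↔ ∈ W`
  have hGB : ∀ x ∈ LZ, subFun F P s δ M x = lidFun P s x := fun x hx =>
    subFun_eq_lidFun hs hx.1.le hx.2.1.le hx.2.2.le
  have hGW : ∀ x ∈ LZ, (lidFun P s x = 0 ↔ x ∈ W) := by
    intro x hx
    constructor
    · intro h0
      rw [hW, subSphere_eq hP hN hS]
      exact Or.inl (Or.inl ⟨h0, by linarith [hx.2.1]⟩)
    · intro hxW
      rw [← hGB x hx]; exact hxW.2
  -- the agreement set
  set C : Set (EuclideanSpace ℝ (Fin 3)) := {x | (FB x < 0 ↔ lidFun P s x < 0) ∧ (0 < FB x ↔ 0 < lidFun P s x)} with hC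
  have hWC : ∀ x ∈ LZ, x ∈ W → x ∈ C := by
    intro x hx hxW
    have h1 : FB x = 0 := (hFBZ x).2 hxW
    have h2 : lidFun P s x = 0 := (hGW x hx).2 hxW
    show (FB x < 0 ↔ lidFun P s x < 0) ∧ (0 < FB x ↔ 0 < lidFun P s x)
    rw [h1, h2]
    exact ⟨Iff.rfl, Iff.rfl⟩
  have hGc : Continuous (lidFun P s) := (contDiff_lidFun (s := s) hP.hP).continuous
  have hFc : Continuous FB := hFBs.continuous
  -- near a point of `LZ ∖ W` both functions keep their (nonzero) signs
  have hstable : ∀ x ∈ LZ, x ∉ W → ∀ᶠ x' in 𝓝 x, (FB x' < 0 ↔ FB x < 0) ∧ (0 < FB x' ↔ 0 < FB x) ∧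
      (lidFun P s x' < 0 ↔ lidFun P s x < 0) ∧ (0 < lidFun P s x' ↔ 0 < lidFun P s x) := by
    intro x hx hxW
    have hF0 : FB x ≠ 0 := fun h => hxW ((hFBZ x).1 h)
    have hG0 : lidFun P s x ≠ 0 := fun h => hxW ((hGW x hx).1 h)
    have key : ∀ (H : EuclideanSpace ℝ (Fin 3) → ℝ), Continuous H → H x ≠ 0 →
        ∀ᶠ x' in 𝓝 x, (H x' < 0 ↔ H x < 0) ∧ (0 < H x' ↔ 0 < H x) := by
      intro H hH hH0
      rcases lt_or_gt_of_ne hH0 with hneg | hpos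
      · filter_upwards [hH.continuousAt.eventually (eventually_lt_nhds hneg)] with x' hx'
        exact ⟨⟨fun _ => hneg, fun _ => hx'⟩, ⟨fun h => absurd hx' (by linarith), fun h => absurd hneg (by linarith)⟩⟩
      · filter_upwards [hH.continuousAt.eventually (eventually_gt_nhds hpos)] with x' hx'
        exact ⟨⟨fun h => absurd hx' (by linarith), fun h => absurd hpos (by linarith)⟩, ⟨fun _ => hpos, fun _ => hx'⟩⟩
    filter_upwards [key FB hFc hF0, key (lidFun P s) hGc hG0] with x' h1 h2
    exact ⟨h1.1, h1.2, h2.1, h2.2⟩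
  -- `C ∩ LZ` is open
  have hopen : ∀ x ∈ LZ, x ∈ C → ∀ᶠ x' in 𝓝 x, x' ∈ C := by
    intro x hx hxC
    by_cases hxW : x ∈ W
    · -- by the local same-side lemma
      obtain ⟨μ, hμ, hD⟩ := hco x hxW
      have hev : subFun F P s δ M =ᶠ[𝓝 x] lidFun P s := by
        filter_upwards [hLZo.mem_nhds hx] with x' hx' using hGB x' hx'
      have hDG : fderiv ℝ (subFun F P s δ M) x = fderiv ℝ (lidFun P s) x := hev.fderiv_eq
      have hZ' : ∀ᶠ x' in 𝓝 x, FB x' = 0 ↔ lidFun P s x' = 0 := by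
        filter_upwards [hLZo.mem_nhds hx] with x' hx'
        rw [hFBZ, hGW x' hx']
      have hG0 : lidFun P s x = 0 := (hGW x hx).2 hxW
      have hDGne : fderiv ℝ (lidFun P s) x ≠ 0 :=
        fderiv_lidFun_ne_zero hP.hP0 hP.hPle hP.differentiable hP.hPd hs (by linarith) hG0
      exact SideComparison.eventually_sign_iff hFBs ((contDiff_lidFun hP.hP).of_le (by simp)) hG0 hZ' hDGne hμ
        (by rw [hD, hDG])
    · filter_upwards [hstable x hx hxW] with x' h
      obtain ⟨h1, h2, h3, h4⟩ := h
      exact ⟨(h1.trans hxC.1).trans h3.symm, (h2.trans hxC.2).trans h4.symm⟩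
  -- `C ∩ LZ` is closed in `LZ`
  have hclosed : ∀ x ∈ LZ, (∃ᶠ x' in 𝓝 x, x' ∈ C) → x ∈ C := by
    intro x hx hfr
    by_cases hxW : x ∈ W
    · exact hWC x hx hxW
    · obtain ⟨x', hx'C, h⟩ := (hfr.and_eventually (hstable x hx hxW)).exists
      obtain ⟨h1, h2, h3, h4⟩ := h
      exact ⟨(h1.symm.trans hx'C.1).trans h3, (h2.symm.trans hx'C.2).trans h4⟩
  -- connectedness of `LZ` (convex)
  have hLZconv : Convex ℝ LZ := by
    intro a ha b hb t₁ t₂ ht₁ ht₂ hts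
    refine ⟨?_, ?_, ?_⟩
    · -- `hsq` is convex: `hsq (t₁ a + t₂ b) ≤ t₁ hsq a + t₂ hsq b`
      have jensen : ∀ u v : ℝ, (t₁ * u + t₂ * v) ^ 2 ≤ t₁ * u ^ 2 + t₂ * v ^ 2 := by
        intro u v
        have e : t₂ = 1 - t₁ := by linarith
        rw [e]
        have key : t₁ * u ^ 2 + (1 - t₁) * v ^ 2 - (t₁ * u + (1 - t₁) * v) ^ 2 = t₁ * (1 - t₁) * (u - v) ^ 2 := by
          ring
        nlinarith [mul_nonneg (mul_nonneg ht₁ (by linarith : (0:ℝ) ≤ 1 - t₁)) (sq_nonneg (u - v))]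
      have hle : hsq (t₁ • a + t₂ • b) ≤ t₁ * hsq a + t₂ * hsq b := by
        simp only [hsq, PiLp.add_apply, PiLp.smul_apply, smul_eq_mul]
        nlinarith [jensen (a 0) (b 0), jensen (a 1) (b 1)]
      show hsq (t₁ • a + t₂ • b) < (1 + 2 * s) ^ 2
      have hR := congrArg (fun r : ℝ => r * (1 + 2 * s) ^ 2) hts
      simp only [add_mul, one_mul] at hR
      rcases ht₁.lt_or_eq with h | h
      · nlinarith [mul_lt_mul_of_pos_left ha.1 h, mul_le_mul_of_nonneg_left hb.1.le ht₂]
      · rw [← h] at hts hle hR ⊢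
        simp only [zero_add, zero_mul] at hts hR hle
        rw [hts] at hle ⊢
        nlinarith [hb.1]
    · show -(5 * s / 2) < (t₁ • a + t₂ • b) 2
      simp only [PiLp.add_apply, PiLp.smul_apply, smul_eq_mul]
      rcases ht₁.lt_or_eq with h | h
      · nlinarith [ha.2.1, hb.2.1, mul_le_mul_of_nonneg_left hb.2.1.le ht₂]
      · rw [← h] at hts ⊢; simp only [zero_add] at hts; rw [hts]; linarith [hb.2.1]
    · show (t₁ • a + t₂ • b) 2 < 3 * s / 2
      simp only [PiLp.add_apply, PiLp.smul_apply, smul_eq_mul]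
      rcases ht₁.lt_or_eq with h | h
      · nlinarith [ha.2.2, hb.2.2, mul_le_mul_of_nonneg_left hb.2.2.le ht₂]
      · rw [← h] at hts ⊢; simp only [zero_add] at hts; rw [hts]; linarith [hb.2.2]
  have hLZconn : IsPreconnected LZ := hLZconv.isPreconnected
  -- the apex is in `LZ ∩ C`
  set pa : EuclideanSpace ℝ (Fin 3) := s • EuclideanSpace.single (2 : Fin 3) (1 : ℝ) with hpa
  have hpa2 : pa 2 = s := by simp [hpa]
  have hpah : hsq pa = 0 := by simp [hsq, hpa]
  have hpaLZ : pa ∈ LZ := ⟨by rw [hpah]; positivity, by rw [hpa2]; linarith, by rw [hpa2]; linarith⟩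
  have hpaW : pa ∈ W := by
    have ha : topFun s pa = 0 := by unfold topFun; rw [hpa2, hpah]; ring
    exact domeDisc_subset hP hN hS ha (by rw [hpah]; linarith)
  -- conclude by connectedness: `LZ ⊆ C`
  have hyLZ : y ∈ LZ := ⟨hy1, hy2, hy3⟩
  by_contra hyC
  -- the open sets `interior C`-like: use `U = {x | ∀ᶠ x' in 𝓝 x, x' ∈ C}` and `V = {x | ∀ᶠ x' in 𝓝 x, x' ∉ C}`
  set U : Set (EuclideanSpace ℝ (Fin 3)) := {x | ∀ᶠ x' in 𝓝 x, x' ∈ C} with hU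
  set V : Set (EuclideanSpace ℝ (Fin 3)) := {x | ∀ᶠ x' in 𝓝 x, x' ∉ C} with hV
  have hUo : IsOpen U := isOpen_setOf_eventually_nhds
  have hVo : IsOpen V := isOpen_setOf_eventually_nhds
  have hcov : LZ ⊆ U ∪ V := by
    intro x hx
    by_cases hxC : x ∈ C
    · exact Or.inl (hopen x hx hxC)
    · right
      show ∀ᶠ x' in 𝓝 x, x' ∉ C
      by_contra hnot
      have : ∃ᶠ x' in 𝓝 x, x' ∈ C := by
        rw [Filter.Frequently]; simpa using hnot
      exact hxC (hclosed x hx this)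
  obtain ⟨x, -, hxU, hxV⟩ := hLZconn U V hUo hVo hcov ⟨pa, hpaLZ, hopen pa hpaLZ (hWC pa hpaLZ hpaW)⟩
    ⟨y, hyLZ, by
      show ∀ᶠ x' in 𝓝 y, x' ∉ C
      by_contra hnot
      have : ∃ᶠ x' in 𝓝 y, x' ∈ C := by rw [Filter.Frequently]; simpa using hnot
      exact hyC (hclosed y hyLZ this)⟩
  have := (Filter.Eventually.and hxU hxV).exists
  obtain ⟨x', h1, h2⟩ := this
  exact h2 h1



section Certification

variable (hP : Admissible P) (hN : StepNF F E₁ E₂ w₀ η₀ ε₀) (hS : StepScale s δ w₀ η₀)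
  {FB : EuclideanSpace ℝ (Fin 3) → ℝ} (hFBc : Continuous FB)
  (hFBZ : ∀ x, FB x = 0 ↔ x ∈ subSphere F P E₁ s δ ε₀) (hK : IsCompact {x | FB x ≤ 0})
include hP hN hS hFBc hFBZ hK

omit hP hN hS hK in
/-- **A connected `W`-free set with a point of `B°` lies in `B°`.** [folklore] -/
theorem subset_of_isPreconnected {U : Set (EuclideanSpace ℝ (Fin 3))} (hU : IsPreconnected U)
    (hUW : ∀ x ∈ U, x ∉ subSphere F P E₁ s δ ε₀) {x₀ : EuclideanSpace ℝ (Fin 3)} (hx₀ : x₀ ∈ U) (hx₀B : FB x₀ < 0) :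
    ∀ x ∈ U, FB x < 0 := by
  have h0 : ∀ x ∈ U, FB x ≠ 0 := fun x hx h => hUW x hx ((hFBZ x).1 h)
  rcases AlexanderTools.forall_pos_or_forall_neg hU hFBc.continuousOn h0 with h | h
  · exact absurd (h x₀ hx₀) (not_lt.2 hx₀B.le)
  · exact h

omit hP hN hS in
/-- **Far outside, `F_B > 0`.**  If `W` lies in the open ball of radius `R₁ > 0` then
`F_B > 0` on the closed exterior of that ball (a connected, unbounded, `W`-free set).
[folklore] -/
theorem FB_pos_of_le_norm {R₁ : ℝ} (hR₁ : 0 < R₁) (hWR : ∀ w ∈ subSphere F P E₁ s δ ε₀, ‖w‖ < R₁)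
    {x : EuclideanSpace ℝ (Fin 3)} (hx : R₁ ≤ ‖x‖) : 0 < FB x := by
  have h0 : ∀ y ∈ {y : EuclideanSpace ℝ (Fin 3) | R₁ ≤ ‖y‖}, FB y ≠ 0 := by
    intro y hy h
    have := hWR y ((hFBZ y).1 h)
    exact absurd this (not_lt.2 hy)
  exact AlexanderTools.forall_pos_of_not_isBounded (isPreconnected_setOf_le_norm hR₁)
    (not_isBounded_setOf_le_norm R₁) hFBc.continuousOn h0 hK x hx

omit hP hN hS in
/-- **The solid `B` lies strictly below any height exceeding all of `W`**: the height on the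
compact `B = {F_B ≤ 0}` is maximised at a point of `W`. [folklore] -/
theorem apply_two_lt_of_nonpos {q₂ : ℝ} (hq : ∀ w ∈ subSphere F P E₁ s δ ε₀, w 2 < q₂)
    {b : EuclideanSpace ℝ (Fin 3)} (hb : FB b ≤ 0) : b 2 < q₂ := by
  obtain ⟨bs, hbs, hmax⟩ := hK.exists_isMaxOn ⟨b, hb⟩ (continuous_coord 2).continuousOn
  have hbs0 : FB bs = 0 := by
    have hbs' : FB bs ≤ 0 := hbs
    rcases hbs'.lt_or_eq with hlt | heq
    · exfalso
      obtain ⟨ε, hε, hball⟩ := Metric.isOpen_iff.1 (isOpen_lt hFBc continuous_const) bs hlt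
      have hmem : bs + (ε / 2) • EuclideanSpace.single (2 : Fin 3) (1 : ℝ) ∈ {x | FB x ≤ 0} := by
        refine (show FB (bs + (ε / 2) • EuclideanSpace.single (2 : Fin 3) (1 : ℝ)) < 0 from hball ?_).le
        rw [mem_ball, dist_eq_norm, add_sub_cancel_left, norm_smul, Real.norm_eq_abs, abs_of_pos (by positivity)]
        simp; linarith
      have := hmax hmem
      simp at this
      linarith
    · exact heq
  have h1 : b 2 ≤ bs 2 := hmax hb
  exact lt_of_le_of_lt h1 (hq bs ((hFBZ bs).1 hbs0))

omit hP hN hS in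
/-- Symmetrically, `B` lies strictly above any height below all of `W`. [folklore] -/
theorem lt_apply_two_of_nonpos {q₂ : ℝ} (hq : ∀ w ∈ subSphere F P E₁ s δ ε₀, q₂ < w 2)
    {b : EuclideanSpace ℝ (Fin 3)} (hb : FB b ≤ 0) : q₂ < b 2 := by
  obtain ⟨bs, hbs, hmin⟩ := hK.exists_isMinOn ⟨b, hb⟩ (continuous_coord 2).continuousOn
  have hbs0 : FB bs = 0 := by
    have hbs' : FB bs ≤ 0 := hbs
    rcases hbs'.lt_or_eq with hlt | heq
    · exfalso
      obtain ⟨ε, hε, hball⟩ := Metric.isOpen_iff.1 (isOpen_lt hFBc continuous_const) bs hlt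
      have hmem : bs + (-(ε / 2)) • EuclideanSpace.single (2 : Fin 3) (1 : ℝ) ∈ {x | FB x ≤ 0} := by
        refine (show FB (bs + (-(ε / 2)) • EuclideanSpace.single (2 : Fin 3) (1 : ℝ)) < 0 from hball ?_).le
        rw [mem_ball, dist_eq_norm, add_sub_cancel_left, norm_smul, Real.norm_eq_abs, abs_of_neg (by linarith)]
        simp; linarith
      have := hmin hmem
      simp at this
      linarith
    · exact heq
  have h1 : bs 2 ≤ b 2 := hmin hb
  exact lt_of_lt_of_le (hq bs ((hFBZ bs).1 hbs0)) h1

omit hFBc hFBZ hK in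
/-- A zero of the filled function in the closed box has `ρ² ≤ (1+s)² + δ`. [folklore] -/
theorem hsq_le_of_fillFun_eq_zero' {x : EuclideanSpace ℝ (Fin 3)}
    (hx : fillFun F P s δ ((1 + s) ^ 2 + ε₀ + 2) x = 0) (hxB : x ∈ closedBox s) :
    hsq x ≤ (1 + s) ^ 2 + δ := by
  obtain ⟨hs, hs1, hsw, hsη, hδ, hδs⟩ := scales hS
  have hε₀ := hN.hε₀
  obtain ⟨h1, h2, h3⟩ := hxB
  have hF : F x = hsq x - 1 := F_eq_of_box hN hS h1 (abs_le.2 ⟨by linarith, by linarith⟩)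
  have hmin := min_sub_le_fillFun hP.hPle hδ (F := F) (s := s) (M := (1 + s) ^ 2 + ε₀ + 2) x (P := P)
  have hmin' : min (F x) (fillWeight P s δ ((1 + s) ^ 2 + ε₀ + 2) x - 1) ≤ δ := by linarith [hx]
  rcases min_le_iff.1 hmin' with hF' | hw'
  · rw [hF] at hF'; nlinarith
  · have hwt := one_add_lidFun_le_fillWeight hs hδ.le (by positivity : (0 : ℝ) ≤ (1 + s) ^ 2 + ε₀ + 2) x (P := P)
    have hrim : rimFun s x ≤ lidFun P s x := (le_max_right _ _).trans (max_le_lidFun hP.hPge hs x)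
    unfold rimFun at hrim
    have hr1 := rimRadius_le hs (x 2)
    have hr0 := rimRadius_nonneg hs (x 2)
    nlinarith

omit hFBc hFBZ hK in
/-- A zero of the filled function in the closed box off `W` lies above `-5s/2`; below height
`2s` its lid function is positive; above height `3s/2` it is a zero of `F` (a wall point).
[folklore] -/
theorem facts_of_zero_off {x : EuclideanSpace ℝ (Fin 3)}
    (hx : fillFun F P s δ ((1 + s) ^ 2 + ε₀ + 2) x = 0) (hxB : x ∈ closedBox s) (hxW : x ∉ subSphere F P E₁ s δ ε₀) :
    -(5 * s / 2) < x 2 ∧ (x 2 < 2 * s → 0 < lidFun P s x) ∧ (3 * s / 2 ≤ x 2 → F x = 0) := by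
  obtain ⟨hs, hs1, hsw, hsη, hδ, hδs⟩ := scales hS
  have hε₀ := hN.hε₀
  set M := (1 + s) ^ 2 + ε₀ + 2 with hM
  have hh := hsq_le_of_fillFun_eq_zero' hP hN hS hx hxB
  obtain ⟨h1, h2, h3⟩ := id hxB
  have hz : -(5 * s / 2) < x 2 := by
    by_contra hle; push Not at hle
    exact hxW (by rw [subSphere_eq hP hN hS]; exact Or.inl (Or.inr ⟨hx, hle, hxB⟩))
  have hle := fillFun_le_min hP.hPge hδ (F := F) (s := s) (M := M) x (P := P)
  have hmin0 : (0 : ℝ) ≤ min (F x) (fillWeight P s δ M x - 1) := by rw [← hx]; exact hle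
  refine ⟨hz, fun hz2 => ?_, fun hz3 => ?_⟩
  · -- in the lid box `w - 1 = G`
    have hw : fillWeight P s δ M x = 1 + lidFun P s x :=
      fillWeight_eq_of_mem_box hs (by nlinarith) (by linarith) hz2.le
    have hG0 : 0 ≤ lidFun P s x := by
      have := hmin0.trans (min_le_right _ _); rw [hw] at this; linarith
    rcases hG0.lt_or_eq with h | h
    · exact h
    · exfalso
      exact hxW (by rw [subSphere_eq hP hN hS]; exact Or.inl (Or.inl ⟨h.symm, by linarith⟩))
  · -- above `3s/2`: `w - 1 ≥ G ≥ a ≥ s/2 > δ`, so `F₂ = F`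
    have htop : s / 2 ≤ topFun s x := by unfold topFun; nlinarith [hsq_nonneg x]
    have hGge : s / 2 ≤ lidFun P s x := htop.trans ((le_max_left _ _).trans (max_le_lidFun hP.hPge hs x))
    have hwt := one_add_lidFun_le_fillWeight hs hδ.le (by positivity : (0 : ℝ) ≤ M) x (P := P)
    by_cases hcase : F x ≤ (fillWeight P s δ M x - 1) - δ
    · rw [fillFun_eq_left hP.hP0 hδ hcase] at hx; exact hx
    · exfalso
      push Not at hcase
      have hmin := min_sub_le_fillFun hP.hPle hδ (F := F) (s := s) (M := M) x (P := P)
      have : δ < min (F x) (fillWeight P s δ M x - 1) := lt_min (by linarith) (by linarith)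
      linarith [hx]


section Disc

variable {D₁ : Set (EuclideanSpace ℝ (Fin 3))}
  (hD₁conn : IsPreconnected (D₁ \ {x | hsq x = 1 ∧ x 2 = 0})) (hD₁E₁ : D₁ ⊆ E₁)
  (hwall : ∀ p, F p = 0 → p ∈ closedBox s → 0 < p 2 → p ∈ D₁)
  (hext : ∃ q ∈ D₁, q ∉ closedBox s ∧
    ((s < q 2 ∧ ∀ p ∈ E₂, p ∉ closedBox s → p 2 < q 2) ∨ (q 2 < -(6 * s) ∧ ∀ p ∈ E₂, p ∉ closedBox s → q 2 < p 2)))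
include hD₁conn hD₁E₁ hwall hext

omit hwall in
/-- **`F_B > 0` on the kept disc off the circle**: that set is connected and `W`-free, and its
far point above (or below) all of `W` lies outside `B`. [folklore] -/
theorem FB_pos_of_mem_disc {x : EuclideanSpace ℝ (Fin 3)} (hx : x ∈ D₁) (hxc : ¬ (hsq x = 1 ∧ x 2 = 0)) : 0 < FB x := by
  obtain ⟨hs, hs1, hsw, hsη, hδ, hδs⟩ := scales hS
  have hWfree : ∀ y ∈ D₁ \ {x : EuclideanSpace ℝ (Fin 3) | hsq x = 1 ∧ x 2 = 0}, y ∉ subSphere F P E₁ s δ ε₀ := by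
    rintro y ⟨hyD, hyc⟩ hyW
    exact hyc (hsq_eq_one_and_of_mem hP hN hS hyW (hD₁E₁ hyD))
  obtain ⟨q, hqD, hqB, hqext⟩ := hext
  have hqc : ¬ (hsq q = 1 ∧ q 2 = 0) := by
    rintro ⟨h1, h2⟩; exact hqB ⟨by rw [h1]; nlinarith, by rw [h2]; linarith, by rw [h2]; linarith⟩
  -- `F_B q > 0` by the height bound
  have hqpos : 0 < FB q := by
    by_contra hle; push Not at hle
    rcases hqext with ⟨hqs, hqE⟩ | ⟨hqs, hqE⟩
    · have hW : ∀ w ∈ subSphere F P E₁ s δ ε₀, w 2 < q 2 := by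
        intro w hw
        rcases mem_closedBox_or_of_mem_subSphere hP hN hS hw with ⟨-, -, hws⟩ | ⟨hwE, hwB⟩
        · linarith
        · exact hqE w hwE hwB
      exact lt_irrefl _ (apply_two_lt_of_nonpos hFBc hFBZ hK hW hle)
    · have hW : ∀ w ∈ subSphere F P E₁ s δ ε₀, q 2 < w 2 := by
        intro w hw
        rcases mem_closedBox_or_of_mem_subSphere hP hN hS hw with ⟨-, hw6, -⟩ | ⟨hwE, hwB⟩
        · linarith
        · exact hqE w hwE hwB
      exact lt_irrefl _ (lt_apply_two_of_nonpos hFBc hFBZ hK hW hle)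
  -- constant sign on the connected `W`-free set
  have h0 : ∀ y ∈ D₁ \ {x : EuclideanSpace ℝ (Fin 3) | hsq x = 1 ∧ x 2 = 0}, FB y ≠ 0 :=
    fun y hy h => hWfree y hy ((hFBZ y).1 h)
  rcases AlexanderTools.forall_pos_or_forall_neg hD₁conn hFBc.continuousOn h0 with h | h
  · exact h x ⟨hx, hxc⟩
  · exact absurd (h q ⟨hqD, hqc⟩) (not_lt.2 hqpos.le)

set_option maxHeartbeats 800000 in
/-- **The co-orientation factor at the apex is positive.**  Otherwise `F_B < 0` just above the
apex, so on the whole upper tube `{ρ² < 1, s < x₂ < 3s}` (connected, `W`-free), so at the wall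
point `(1, 0, 2s)` of the kept disc — contradicting `FB_pos_of_mem_disc`. [folklore] -/
theorem factor_pos_apex (hFBs : ContDiff ℝ 1 FB) {a : EuclideanSpace ℝ (Fin 3)} (ha0 : a 0 = 0) (ha1 : a 1 = 0) (ha2 : a 2 = s)
    {μ : ℝ} (hμ0 : μ ≠ 0)
    (hμ : fderiv ℝ FB a = μ • fderiv ℝ (subFun F P s δ ((1 + s) ^ 2 + ε₀ + 2)) a) : 0 < μ := by
  obtain ⟨hs, hs1, hsw, hsη, hδ, hδs⟩ := scales hS
  obtain ⟨haW, hev⟩ := apex_mem hP hN hS ha0 ha1 ha2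
  by_contra hle
  push Not at hle
  have hμneg : μ < 0 := lt_of_le_of_ne hle hμ0
  set e₂ : EuclideanSpace ℝ (Fin 3) := EuclideanSpace.single (2 : Fin 3) (1 : ℝ) with he₂
  -- `DF_B(a) e₂ = μ`
  have hDa : fderiv ℝ FB a e₂ = μ := by
    rw [hμ, hev.fderiv_eq, fderiv_lidFun_apex hP.hP0 hs (by linarith) ha0 ha1 ha2]
    simp [he₂]
  have hFBd : Differentiable ℝ FB := hFBs.differentiable (by simp)
  have hneg := ExpHeight.exists_pos_apply_add_smul_neg hFBd ((hFBZ a).2 haW) (by rw [hDa]; exact hμneg)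
  obtain ⟨t, ht, htI⟩ := (hneg.and (Ioo_mem_nhdsGT (show (0 : ℝ) < s by linarith))).exists
  -- the upper tube
  set T : Set (EuclideanSpace ℝ (Fin 3)) := {x | hsq x < 1 ∧ s < x 2 ∧ x 2 < 3 * s} with hT
  have hTW : ∀ x ∈ T, x ∉ subSphere F P E₁ s δ ε₀ := by
    rintro x ⟨hx1, hx2, hx3⟩ hxW
    rcases mem_closedBox_or_of_mem_subSphere hP hN hS hxW with ⟨-, -, hxs⟩ | ⟨-, hxB⟩
    · linarith
    · exact hxB ⟨by nlinarith [hsq_nonneg x], by linarith, by linarith⟩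
  have hTconv : Convex ℝ T := by
    intro u hu v hv t₁ t₂ ht₁ ht₂ hts
    have jensen : ∀ p q : ℝ, (t₁ * p + t₂ * q) ^ 2 ≤ t₁ * p ^ 2 + t₂ * q ^ 2 := by
      intro p q
      have e : t₂ = 1 - t₁ := by linarith
      rw [e]
      nlinarith [mul_nonneg (mul_nonneg ht₁ (by linarith : (0:ℝ) ≤ 1 - t₁)) (sq_nonneg (p - q))]
    refine ⟨?_, ?_, ?_⟩
    · show hsq (t₁ • u + t₂ • v) < 1
      simp only [hsq, PiLp.add_apply, PiLp.smul_apply, smul_eq_mul]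
      have hu1 : u 0 ^ 2 + u 1 ^ 2 < 1 := hu.1
      have hv1 : v 0 ^ 2 + v 1 ^ 2 < 1 := hv.1
      have h := jensen (u 0) (v 0)
      have h' := jensen (u 1) (v 1)
      rcases ht₁.lt_or_eq with h1 | h1
      · nlinarith
      · rw [← h1] at hts ⊢; simp only [zero_add] at hts; rw [hts]; simp; nlinarith
    · show s < (t₁ • u + t₂ • v) 2
      simp only [PiLp.add_apply, PiLp.smul_apply, smul_eq_mul]
      rcases ht₁.lt_or_eq with h1 | h1
      · nlinarith [hu.2.1, hv.2.1]
      · rw [← h1] at hts ⊢; simp only [zero_add] at hts; rw [hts]; linarith [hv.2.1]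
    · show (t₁ • u + t₂ • v) 2 < 3 * s
      simp only [PiLp.add_apply, PiLp.smul_apply, smul_eq_mul]
      rcases ht₁.lt_or_eq with h1 | h1
      · nlinarith [hu.2.2, hv.2.2]
      · rw [← h1] at hts ⊢; simp only [zero_add] at hts; rw [hts]; linarith [hv.2.2]
  have hx₀T : a + t • e₂ ∈ T := by
    have h0 : (a + t • e₂) 0 = 0 := by simp [he₂, ha0]
    have h1 : (a + t • e₂) 1 = 0 := by simp [he₂, ha1]
    have h2 : (a + t • e₂) 2 = s + t := by simp [he₂, ha2]
    exact ⟨by simp [hsq, h0, h1], by rw [h2]; linarith [htI.1], by rw [h2]; linarith [htI.2]⟩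
  have hTneg : ∀ x ∈ T, FB x < 0 := subset_of_isPreconnected hFBc hFBZ hTconv.isPreconnected hTW hx₀T ht
  -- the wall point `(1, 0, 2s)` is in the closure of `T`
  set qw : EuclideanSpace ℝ (Fin 3) := EuclideanSpace.single (0 : Fin 3) (1 : ℝ) + (2 * s) • e₂ with hqw
  have hqw0 : qw 0 = 1 := by simp [hqw, he₂]
  have hqw1 : qw 1 = 0 := by simp [hqw, he₂]
  have hqw2 : qw 2 = 2 * s := by simp [hqw, he₂]
  have hqwh : hsq qw = 1 := by simp [hsq, hqw0, hqw1]
  have hqwcl : qw ∈ closure T := by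
    have htend : Tendsto (fun ε : ℝ => qw - ε • EuclideanSpace.single (0 : Fin 3) (1 : ℝ)) (𝓝[>] 0) (𝓝 qw) := by
      have : Tendsto (fun ε : ℝ => qw - ε • EuclideanSpace.single (0 : Fin 3) (1 : ℝ)) (𝓝 0)
          (𝓝 (qw - (0 : ℝ) • EuclideanSpace.single (0 : Fin 3) (1 : ℝ))) :=
        (continuous_const.sub (continuous_id.smul continuous_const)).tendsto 0
      rw [zero_smul, sub_zero] at this
      exact this.mono_left nhdsWithin_le_nhds
    refine mem_closure_of_tendsto htend ?_
    filter_upwards [Ioo_mem_nhdsGT (show (0 : ℝ) < 1 by norm_num)] with ε hε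
    have h0 : (qw - ε • EuclideanSpace.single (0 : Fin 3) (1 : ℝ)) 0 = 1 - ε := by simp [hqw0]
    have h1 : (qw - ε • EuclideanSpace.single (0 : Fin 3) (1 : ℝ)) 1 = 0 := by simp [hqw1]
    have h2 : (qw - ε • EuclideanSpace.single (0 : Fin 3) (1 : ℝ)) 2 = 2 * s := by simp [hqw2]
    refine ⟨?_, by rw [h2]; linarith, by rw [h2]; linarith⟩
    show hsq _ < 1
    simp only [hsq, h0, h1]; nlinarith [hε.1, hε.2]
  have hqwle : FB qw ≤ 0 := by
    have hsub : T ⊆ {x | FB x ≤ 0} := fun x hx => (hTneg x hx).le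
    exact closure_minimal hsub (isClosed_le hFBc continuous_const) hqwcl
  -- `qw` is a wall point above `0`: in `D₁`, off the circle, so `F_B qw > 0`
  have hqwF : F qw = 0 := by
    rw [hN.hNF qw (by rw [hqwh]; nlinarith [hN.hw₀]) (by rw [hqw2, abs_of_pos (by positivity)]; linarith), hqwh]; ring
  have hqwD : qw ∈ D₁ := hwall qw hqwF ⟨by rw [hqwh]; nlinarith, by rw [hqw2]; linarith, by rw [hqw2]; linarith⟩
    (by rw [hqw2]; positivity)
  have := FB_pos_of_mem_disc hP hN hS hFBc hFBZ hK hD₁conn hD₁E₁ hext hqwD (by rw [hqw2]; rintro ⟨-, h⟩; linarith)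
  linarith

/-- **The co-orientation factor is positive along `W`.** [folklore] -/
theorem factor_pos_all (hFBs : ContDiff ℝ 1 FB)
    (hprop : ∀ x ∈ subSphere F P E₁ s δ ε₀, ∃ μ : ℝ, μ ≠ 0 ∧
      fderiv ℝ FB x = μ • fderiv ℝ (subFun F P s δ ((1 + s) ^ 2 + ε₀ + 2)) x)
    (hWconn : IsConnected (subSphere F P E₁ s δ ε₀)) :
    ∀ x ∈ subSphere F P E₁ s δ ε₀, ∃ μ : ℝ, 0 < μ ∧
      fderiv ℝ FB x = μ • fderiv ℝ (subFun F P s δ ((1 + s) ^ 2 + ε₀ + 2)) x := by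
  obtain ⟨hs, -, -, -, -, -⟩ := scales hS
  set a : EuclideanSpace ℝ (Fin 3) := s • EuclideanSpace.single (2 : Fin 3) (1 : ℝ) with ha
  have ha0 : a 0 = 0 := by simp [ha]
  have ha1 : a 1 = 0 := by simp [ha]
  have ha2 : a 2 = s := by simp [ha]
  have haW := (apex_mem hP hN hS ha0 ha1 ha2).1
  obtain ⟨μ, hμ0, hμ⟩ := hprop a haW
  have hμpos := factor_pos_apex hP hN hS hFBc hFBZ hK hD₁conn hD₁E₁ hwall hext hFBs ha0 ha1 ha2 hμ0 hμ
  exact factor_pos_of_connected hP hN hS hWconn hFBs hprop haW ⟨μ, hμpos, hμ⟩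

end Disc

end Certification

/-- **Certification: `{F₂ > 0} ⊆ {F_B > 0}`**, i.e. `B ⊆ A₁ = {F₂ ≤ 0}`.  The connected open
side `{F_B < 0}` contains a point below the apex (inside `A₁`); if it met `{F₂ > 0}` it would
meet `{F₂ = 0}` at a point `p ∉ W`: off the box `p` is on the kept disc (where `F_B > 0`) or far
(where `F_B > 0`); in the box `p` has positive lid function (so `F_B p > 0` by the standard face)
or is a wall point of the kept disc. [folklore] -/
theorem fillFun_pos_of_certified (hP : Admissible P) (hN : StepNF F E₁ E₂ w₀ η₀ ε₀) (hS : StepScale s δ w₀ η₀)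
    {FB : EuclideanSpace ℝ (Fin 3) → ℝ} (hFBs : ContDiff ℝ 1 FB)
    (hFBZ : ∀ x, FB x = 0 ↔ x ∈ subSphere F P E₁ s δ ε₀) (hK : IsCompact {x | FB x ≤ 0})
    (hneg : IsPreconnected {x | FB x < 0})
    (hco : ∀ x ∈ subSphere F P E₁ s δ ε₀, ∃ μ : ℝ, 0 < μ ∧
      fderiv ℝ FB x = μ • fderiv ℝ (subFun F P s δ ((1 + s) ^ 2 + ε₀ + 2)) x)
    {D₁ : Set (EuclideanSpace ℝ (Fin 3))}
    (hD₁conn : IsPreconnected (D₁ \ {x | hsq x = 1 ∧ x 2 = 0})) (hD₁E₁ : D₁ ⊆ E₁)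
    (hwall : ∀ p, F p = 0 → p ∈ closedBox s → 0 < p 2 → p ∈ D₁)
    (hext : ∃ q ∈ D₁, q ∉ closedBox s ∧
      ((s < q 2 ∧ ∀ p ∈ E₂, p ∉ closedBox s → p 2 < q 2) ∨ (q 2 < -(6 * s) ∧ ∀ p ∈ E₂, p ∉ closedBox s → q 2 < p 2)))
    {R₁ : ℝ} (hR₁ : 0 < R₁) (hWR : ∀ w ∈ subSphere F P E₁ s δ ε₀, ‖w‖ < R₁)
    (hfarE₁ : ∀ p ∈ E₁, p ∉ D₁ → R₁ ≤ ‖p‖) :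
    ∀ x, 0 < fillFun F P s δ ((1 + s) ^ 2 + ε₀ + 2) x → 0 < FB x := by
  obtain ⟨hs, hs1, hsw, hsη, hδ, hδs⟩ := scales hS
  have hε₀ := hN.hε₀
  set M := (1 + s) ^ 2 + ε₀ + 2 with hM
  set W := subSphere F P E₁ s δ ε₀ with hW
  have hFBc : Continuous FB := hFBs.continuous
  have hF₂c : Continuous (fillFun F P s δ M) := (contDiff_fillFun hN.hF hP.hP).continuous
  -- the standard face
  have hface : ∀ y, hsq y < (1 + 2 * s) ^ 2 → -(5 * s / 2) < y 2 → y 2 < 3 * s / 2 →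
      (FB y < 0 ↔ lidFun P s y < 0) ∧ (0 < FB y ↔ 0 < lidFun P s y) := fun y h1 h2 h3 =>
    sign_iff_of_mem_lidZone hP hN hS hFBs hFBZ hco h1 h2 h3
  -- a point below the apex, inside `A₁` and inside `B`
  set am : EuclideanSpace ℝ (Fin 3) := (s / 2) • EuclideanSpace.single (2 : Fin 3) (1 : ℝ) with ham
  have ham0 : am 0 = 0 := by simp [ham]
  have ham1 : am 1 = 0 := by simp [ham]
  have ham2 : am 2 = s / 2 := by simp [ham]
  have hamh : hsq am = 0 := by simp [hsq, ham0, ham1]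
  have hamG : lidFun P s am < 0 := by
    have htop : topFun s am = -(s / 2) := by unfold topFun; rw [ham2, hamh]; ring
    have hrim : rimFun s am ≤ topFun s am - s / 8 := by
      unfold rimFun; rw [htop, hamh]
      have := rimRadius_nonneg hs (am 2)
      nlinarith
    rw [lidFun_eq_topFun hP.hP0 hs hrim, htop]; linarith
  have hamB : FB am < 0 := ((hface am (by rw [hamh]; positivity) (by rw [ham2]; linarith) (by rw [ham2]; linarith)).1).2 hamG
  have hamA : fillFun F P s δ M am < 0 := by
    have hF : F am = hsq am - 1 := F_eq_of_box hN hS (by rw [hamh]; positivity) (by rw [ham2, abs_of_pos (by positivity)]; linarith)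
    have := fillFun_le_min hP.hPge hδ (F := F) (s := s) (M := M) am (P := P)
    rw [hamh] at hF
    linarith [this.trans (min_le_left _ _)]
  intro x₀ hx₀
  by_contra hle
  push Not at hle
  have hx₀W : x₀ ∉ W := fun h => by
    have := fillFun_nonpos_of_mem_subSphere hP hN hS h; linarith
  have hx₀B : FB x₀ < 0 := lt_of_le_of_ne hle fun h => hx₀W ((hFBZ x₀).1 h)
  -- a zero of `F₂` inside `B°`
  obtain ⟨p, hpB, hp0⟩ : ∃ p ∈ {x | FB x < 0}, fillFun F P s δ M p = 0 := by
    have := hneg.intermediate_value hamB hx₀B hF₂c.continuousOn ⟨hamA.le, hx₀.le⟩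
    obtain ⟨p, hp, hp0⟩ := this
    exact ⟨p, hp, hp0⟩
  have hpB' : FB p < 0 := hpB
  have hpW : p ∉ W := fun h => by rw [(hFBZ p).2 h] at hpB'; exact lt_irrefl _ hpB'
  have hcirc : ∀ y, y ∈ D₁ → ¬ (hsq y = 1 ∧ y 2 = 0) → 0 < FB y := fun y hy hyc =>
    FB_pos_of_mem_disc hP hN hS hFBc hFBZ hK hD₁conn hD₁E₁ hext hy hyc
  by_cases hpBox : p ∈ closedBox s
  · obtain ⟨hz5, hGof, hwallF⟩ := facts_of_zero_off hP hN hS hp0 hpBox hpW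
    by_cases hz : p 2 < 3 * s / 2
    · have hh := hsq_le_of_fillFun_eq_zero' hP hN hS hp0 hpBox
      have := ((hface p (by nlinarith) hz5 hz).2).2 (hGof (by linarith))
      linarith
    · push Not at hz
      have hF0 := hwallF hz
      have hpD : p ∈ D₁ := hwall p hF0 hpBox (by linarith)
      have := hcirc p hpD (by rintro ⟨-, h⟩; linarith)
      linarith
  · have hF0 : F p = 0 := (fillFun_eq_zero_iff_of_not_mem hP hN hS hpBox).1 hp0
    have hpZ : p ∈ E₁ ∪ E₂ := by rw [← hN.hZ]; exact hF0
    rcases hpZ with hpE₁ | hpE₂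
    · by_cases hpD : p ∈ D₁
      · have := hcirc p hpD (by
          rintro ⟨h1, h2⟩; exact hpBox ⟨by rw [h1]; nlinarith, by rw [h2]; linarith, by rw [h2]; linarith⟩)
        linarith
      · have := FB_pos_of_le_norm hFBc hFBZ hK hR₁ hWR (hfarE₁ p hpE₁ hpD)
        linarith
    · exact hpW (by rw [hW, subSphere_eq hP hN hS]; exact Or.inr ⟨hpE₂, hpBox⟩)

/-! ### §3 The side function of the sub-sphere -/

/-- **The sub-configuration's side function.**  Let `f : 𝕊² → ℝ³` be a smooth embedding onto
the zero set of the filled function off an excluded closed set `T` (which misses `W` and the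
marked dome point), let `D₁ ⊆ E₁` be the kept disc (connected off the cutting circle, containing
the upper wall, with a far point strictly above or strictly below all far points of `E₂` and the
box levels), and let every point of `E₁ ∖ D₁` be far (norm `≥ R₁`, `W` inside the `R₁`-ball).
Then there are a smooth embedding `f_B : 𝕊² → ℝ³` onto `W` and a smooth `F_B` with zero set `W`,
regular there, `{F_B ≤ ε}` compact for some `ε > 0`, `{F_B < 0} ≠ ∅`, both sides connected,
**`{F₂ > 0} ⊆ {F_B > 0}`**, **positive co-orientation** `DF_B = μ DG_B`, `μ > 0`, along `W`,
and the **standard face** (the signs of `F_B` and of the lid function agree on the lid zone).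
[cite: Schultens2014, proof of Thm. 3.2.5 (PDF p. 45)] -/
theorem exists_subSide (hP : Admissible P) (hN : StepNF F E₁ E₂ w₀ η₀ ε₀) (hS : StepScale s δ w₀ η₀)
    {f : sphere (0 : EuclideanSpace ℝ (Fin 3)) 1 → EuclideanSpace ℝ (Fin 3)}
    (hf : Manifold.IsSmoothEmbedding (𝓡 2) 𝓘(ℝ, EuclideanSpace ℝ (Fin 3)) ∞ f)
    {T : Set (EuclideanSpace ℝ (Fin 3))}
    (hZ₁ : ∀ y, fillFun F P s δ ((1 + s) ^ 2 + ε₀ + 2) (f y) = 0)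
    (hZ₂ : ∀ x, fillFun F P s δ ((1 + s) ^ 2 + ε₀ + 2) x = 0 → x ∉ T → x ∈ range f)
    (hTW : ∀ x ∈ subSphere F P E₁ s δ ε₀, x ∉ T)
    (hTu : EuclideanSpace.single (0 : Fin 3) (1 : ℝ) + s • EuclideanSpace.single (2 : Fin 3) (1 : ℝ) ∉ T)
    {D₁ : Set (EuclideanSpace ℝ (Fin 3))}
    (hD₁conn : IsPreconnected (D₁ \ {x | hsq x = 1 ∧ x 2 = 0})) (hD₁E₁ : D₁ ⊆ E₁)
    (hwall : ∀ p, F p = 0 → p ∈ closedBox s → 0 < p 2 → p ∈ D₁)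
    (hext : ∃ q ∈ D₁, q ∉ closedBox s ∧
      ((s < q 2 ∧ ∀ p ∈ E₂, p ∉ closedBox s → p 2 < q 2) ∨ (q 2 < -(6 * s) ∧ ∀ p ∈ E₂, p ∉ closedBox s → q 2 < p 2)))
    {R₁ : ℝ} (hR₁ : 0 < R₁) (hWR : ∀ w ∈ subSphere F P E₁ s δ ε₀, ‖w‖ < R₁)
    (hfarE₁ : ∀ p ∈ E₁, p ∉ D₁ → R₁ ≤ ‖p‖) :
    ∃ (FB : EuclideanSpace ℝ (Fin 3) → ℝ) (fB : sphere (0 : EuclideanSpace ℝ (Fin 3)) 1 → EuclideanSpace ℝ (Fin 3)),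
      ContDiff ℝ ∞ FB ∧ (∃ ε, 0 < ε ∧ IsCompact {x | FB x ≤ ε}) ∧ (∀ x, FB x = 0 → fderiv ℝ FB x ≠ 0) ∧
      (∃ x, FB x < 0) ∧
      Manifold.IsSmoothEmbedding (𝓡 2) 𝓘(ℝ, EuclideanSpace ℝ (Fin 3)) ∞ fB ∧
      range fB = {x | FB x = 0} ∧ range fB = subSphere F P E₁ s δ ε₀ ∧
      IsConnected {x | 0 < FB x} ∧ IsConnected {x | FB x < 0} ∧
      (∀ x, 0 < fillFun F P s δ ((1 + s) ^ 2 + ε₀ + 2) x → 0 < FB x) ∧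
      (∀ x ∈ subSphere F P E₁ s δ ε₀, ∃ μ : ℝ, 0 < μ ∧
        fderiv ℝ FB x = μ • fderiv ℝ (subFun F P s δ ((1 + s) ^ 2 + ε₀ + 2)) x) ∧
      (∀ y, hsq y < (1 + 2 * s) ^ 2 → -(5 * s / 2) < y 2 → y 2 < 3 * s / 2 →
        (FB y < 0 ↔ lidFun P s y < 0) ∧ (0 < FB y ↔ 0 < lidFun P s y)) := by
  obtain ⟨hs, hs1, hsw, hsη, hδ, hδs⟩ := scales hS
  set M := (1 + s) ^ 2 + ε₀ + 2 with hM
  set W := subSphere F P E₁ s δ ε₀ with hW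
  -- the embedded sphere and its side function
  obtain ⟨fB, hfB, hrange⟩ := exists_subsphereParam hP hN hS hf (T := T) hZ₁ hZ₂ hTW hTu
  obtain ⟨F₀, hF₀s, hF₀Z, hF₀reg, hF₀K, ⟨xm, hxm'⟩, hF₀neg, hF₀pos⟩ :=
    AlexanderTools.exists_euclidean_sideFunction_connected (m := 2) (by norm_num) hfB
  obtain ⟨FB, hFBs, hFBK, hneg_iff, hzero_iff, hpos_iff, R, -, hKR, hFBeq⟩ :=
    SideComparison.exists_properPos hF₀s hF₀K
  have hFBZ : ∀ x, FB x = 0 ↔ x ∈ W := fun x => by rw [hzero_iff, hF₀Z, hrange]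
  have hFBreg : ∀ x, FB x = 0 → fderiv ℝ FB x ≠ 0 := by
    intro x hx
    have hx0 : F₀ x = 0 := (hzero_iff x).1 hx
    have hxR : x ∈ ball (0 : EuclideanSpace ℝ (Fin 3)) R := hKR (show F₀ x ≤ 0 by rw [hx0])
    have hev : FB =ᶠ[𝓝 x] F₀ := by
      filter_upwards [isOpen_ball.mem_nhds hxR] with y hy using hFBeq y hy
    rw [hev.fderiv_eq]; exact hF₀reg x hx0
  have hsetpos : {x | 0 < FB x} = {x | 0 < F₀ x} := Set.ext fun x => hpos_iff x
  have hsetneg : {x | FB x < 0} = {x | F₀ x < 0} := Set.ext fun x => hneg_iff x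
  have hFBpos : IsConnected {x | 0 < FB x} := hsetpos ▸ hF₀pos
  have hFBneg : IsConnected {x | FB x < 0} := hsetneg ▸ hF₀neg
  have hFBK0 : IsCompact {x | FB x ≤ 0} := by
    have : {x | FB x ≤ 0} = {x | F₀ x ≤ 0} := by
      ext x; simp only [mem_setOf_eq, le_iff_lt_or_eq, hneg_iff x, hzero_iff x]
    rw [this]; exact hF₀K
  -- proportionality with a nonzero factor
  have hGBs : ContDiff ℝ ∞ (subFun F P s δ M) := contDiff_subFun hN.hF hP.hP
  have hprop : ∀ x ∈ W, ∃ μ : ℝ, μ ≠ 0 ∧ fderiv ℝ FB x = μ • fderiv ℝ (subFun F P s δ M) x := by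
    intro x hx
    obtain ⟨y, rfl⟩ : x ∈ range fB := by rw [hrange]; exact hx
    have hmem : ∀ y', fB y' ∈ W := fun y' => by rw [hW, ← hrange]; exact mem_range_self y'
    exact SideComparison.exists_fderiv_eq_smul (m := 2) (by simp)
      ((hfB.contMDiff y).mdifferentiableAt (by simp))
      (injective_mfderiv_of_isImmersionAt' (hfB.isImmersion.isImmersionAt y))
      ((hFBs.differentiable (by simp)) _) (fun y' => (hFBZ _).2 (hmem y'))
      (hFBreg _ ((hFBZ _).2 hx))
      ((hGBs.differentiable (by simp)) _) (fun y' => (hmem y').2) (fderiv_subFun_ne_zero_of_mem hP hN hS hx)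
  have hWconn : IsConnected W := by
    have hr : 1 < Module.rank ℝ (EuclideanSpace ℝ (Fin 3)) := by
      rw [← Module.finrank_eq_rank, finrank_euclideanSpace_fin]; exact_mod_cast (by norm_num : 1 < 3)
    haveI : ConnectedSpace (sphere (0 : EuclideanSpace ℝ (Fin 3)) 1) :=
      isConnected_iff_connectedSpace.1 (isConnected_sphere hr 0 zero_le_one)
    rw [hW, ← hrange, ← image_univ]
    exact isConnected_univ.image _ hfB.contMDiff.continuous.continuousOn
  -- positive co-orientation, standard face, certification
  have hco := factor_pos_all hP hN hS hFBs.continuous hFBZ hFBK0 hD₁conn hD₁E₁ hwall hext (hFBs.of_le (by simp))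
    hprop hWconn
  have hface : ∀ y, hsq y < (1 + 2 * s) ^ 2 → -(5 * s / 2) < y 2 → y 2 < 3 * s / 2 →
      (FB y < 0 ↔ lidFun P s y < 0) ∧ (0 < FB y ↔ 0 < lidFun P s y) := fun y h1 h2 h3 =>
    sign_iff_of_mem_lidZone hP hN hS (hFBs.of_le (by simp)) hFBZ hco h1 h2 h3
  have hcert := fillFun_pos_of_certified hP hN hS (hFBs.of_le (by simp)) hFBZ hFBK0 hFBneg.isPreconnected hco
    hD₁conn hD₁E₁ hwall hext hR₁ hWR hfarE₁
  refine ⟨FB, fB, hFBs, hFBK, hFBreg, ⟨xm, (hneg_iff xm).2 hxm'⟩, hfB, ?_, hrange, hFBpos, hFBneg, hcert, hco, hface⟩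
  rw [hrange]; exact (Set.ext hFBZ).symm

end CappedBallLid

end Literature.Topology.FourManifolds

end
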